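import Summits.HodgeConjecture.HodgeConjecture.Theorems.HCCMUnconditionalSiegelDebtClosers   -- ★ `stubW0_holds`, `siegelModuli_complexUniformisation_holds`; ★ E-FU head `M1primeOfFU` (`stubW3`, `MarkedBy.transport`, `translateRightT`, `isAdmissibleAt_of_markedBy`)
import Summits.HodgeConjecture.HodgeConjecture.Theorems.MumfordRouteXiAssembly               -- ★ `MumfordRouteXi.cmConjugationIsogenyAll_holds` (Shimura–Taniyama at the CM special pairs, ∀-markings form)
import HarnessLib

/-!
# Crux `HLiu418` — P6 sub-line **F0-P6a**, E-line organ **E3R-S**: Shimura reciprocity (62) at the CM special pairs ON THE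
# `ℚ`-STRUCTURE POINTS OF ONE SIEGEL FINE MODULI SCHEME (the carrier), the tower deleted

Cell `hodgecm-mathlib`, crux `stmt-HodgeConjecture-24832` (HLiu418), sub-line P6a, E-line `Cruxes/HLiu418/Lines/F0_P6a_PELWitnessE.lean`
(GEN heir A-p18 (g31): the `AuxChartGS.f_recip` field consumed in the `stub_E123` closure), LEAD F0P6-plan (g2) 2026-09-01T22:15:46Z
re-key «E3R-S», KEY = A-p09 (g22) CENSUS-E3R f786646d §0.3 («SIEGEL-SIDE CARRIER RECIPROCITY: (62) at ALL CM special pairs on the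
`ℚ`-structure points of ONE `𝓜 : SiegelFineModuliScheme g N δ` read through A4's `pts`»).  HC_CM is proved only modulo the 2 remaining
named inputs (hLiu418 24832, h413 24833) until rung 0 closes; this file discharges neither (`--supports stmt-HodgeConjecture-24832`,
count-neutral): it is the Siegel half of the glue `σ • f[w,a] = σ • q[J, b a] =(E3R-S) q[J, r·b a] =(E3R-U) q[J, b(d♯ a)] = f[w, d a]`.

WHAT IS PROVED (three steps, each a named theorem; nothing is asserted, no `sorry`, no new definition, no named fact).
Fix `0 < g`, a polarisation type `δ`, `3 ≤ N`, ONE fine moduli scheme `𝓜 : SiegelFineModuliScheme g N δ` over `ℚ`, uniformised pieces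
`ιc c : Sc c ⟶ 𝓜.M ⊗_ℚ ℂ`, `unif c : 𝔥_g → (Sc c)(ℂ)` (`c ∈ (ℤ/N)ˣ`), integral diagonal representatives `rep c = diag(1, u_c·1)` (the
five (U3) premisses of ★ `siegelModuli_complexUniformisation`, = A4 ★ `UnitaryCurve.exists_moduliPointMapGS`'s `(u, rep)` clause), the
(U3-D3) UNIQUENESS clause of ★ (U) for `(𝓜, Sc, ιc, unif)` at the `rep c` («every admissible triple is classified by `unif_c Z`»), and a
point bijection `pts : (𝓜.M ⊗ ℂ)(ℂ) ≃ Sh_{K_δ(N)}(GSp_δ, S^±)(ℂ)` with A4's value clause `pts ((ιc c)(ℂ)(unif c W)) = [J(W), rep c]`.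
Write `q x := (AlgPoints.baseChangeEquiv (algebraMap ℚ ℂ) 𝓜.M)⁻¹ (pts⁻¹ x)` for the `ℚ`-structure point under the class `x`.
* §1 `classifyingMap_eq_of_markedBy` — THE DICTIONARY AT THE CARRIER for the given `pts`: `q [J, aK_δ(N)]` IS the classifying map of
  every `(J, a)`-marked triple over `Spec ℂ` (★ `M1primeOfFU.MarkedBy`).  Proof = the dictionary block of ★ `M1primeOfFU.stub_W1a_of_T2`
  verbatim for an abstract `pts`: move `[J, a]` to a principal representative `[J(Z), rep c]` (★ `SiegelShimuraSet.exists_eq_mk_jOfSiegel`),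
  transport the marking (★ (T) `MarkedBy.transport` over (T2) `translateRightT`), read `unif_c Z = classifyingMap P′` from (U3-D3) and
  `unif_c Z = pts⁻¹ [J(Z), rep c]` from the value clause.
* §2 `smul_q_mk_eq_of_conjHom` — `IsModuli` AT THE CARRIER IN `q`-CURRENCY (★ `SiegelRationalModel.IsModuli` :305 with the tower deleted):
  for `σ ∈ Aut(ℂ/ℚ)`, markings `m`, `m′` of `A`, `A′` by `[J, a]`, `[J′, a′]` and `f : σA → A′` carrying `σ ∘ η_a` to `η_{a′} ∘ k`, `k ∈ K_δ(N)`: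
  `σ • q[J, a] = q[J′, a′]`.  Proof = ★ W0 `stubW0_holds` (marked triples at both classes) + §1 twice + ★ W3 `M1primeOfFU.stubW3`.
* §3 **`smul_q_mk_eq_q_mk_cmRecip` (THE HEAD, E3R-S)** — RECIPROCITY (62) AT ALL CM SPECIAL PAIRS AT THE CARRIER (★ `SiegelRationalModel.IsCanonical`
  :250–:262 with the binder `L : SiegelLevel δ` deleted and `R.ptQ L ((Sg.pts L).symm ·)` replaced by `q`): for every CM structure `c`, special
  pair `(c, J)` of CM types `Φ`, number field `E ⊇ ∏ E*(Φᵢ)`, `σ ∈ Aut(ℂ/E)` with Artin correspondent `s`, `r ∈ GSp_δ(𝔸_f)` of matrix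
  `c.cmRecipMatrix Φ E s`, and every `a`: `σ • q[J, aK_δ(N)] = q[J, r·aK_δ(N)]`.  Proof = ★ `MumfordModuli.isCanonical_of_isModuli` with the tower
  deleted: markings exist (★ `exists_isLatticeBasis`, ★ `SiegelAdelicMarking.exists`), the CM conjugation isogeny `f : σA → A′` is ★
  `MumfordRouteXi.cmConjugationIsogenyAll_holds` ([Shimura1998] Thm. 18.6 ∕ [Milne2005ShimuraVarieties] Thm. 11.2 road, PROVED in the tree), §2 at `k = 1`.
  `smul_q_mk_eq_q_mk_cmRecip_of_forall_mem_apply_eq` is the same for `σ : ℂ ≃ₐ[ℚ] ℂ` fixing `E` pointwise (the shape in which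
  `AuxChartGS.f_recip` and A-p09's E3R-U head act, by `σ.restrictScalars ℚ`); `smul_q_mk_eq_q_mk_cmRecip'` is the head with the (U3)
  clause of ★ (U) and A4's `(u, rep)` clause taken VERBATIM (zero adapters for GEN).

[cite: Milne2005ShimuraVarieties, Def. 12.8 (62) p. 114, §14 Prop. 14.12 p. 125, §6 Thm. 6.11 p. 74, §5 Lemma 5.13 p. 57]
[cite: Deligne1971TravauxShimura, Déf. 3.13 p. 141, 4.16–4.18 p. 150, Thm. 4.21 p. 152] [cite: Shimura1998, §18.6 Thm. 18.6 pp. 124–125]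
-/

set_option autoImplicit false

-- `Summit.HodgeConjecture.HodgeConjecture.…` repeats `HodgeConjecture` by design (D-0017); the lakefile turns `linter.dupNamespace`
-- off tree-wide (weak option), restated here so stand-alone elaboration is warning-free.
set_option linter.dupNamespace false

noncomputable section

open CategoryTheory AlgebraicGeometry Matrix NumberField IsDedekindDomain
open Literature.AlgebraicGeometry.ModuliOfAbelianVarieties
open Literature.AlgebraicGeometry.ModuliOfAbelianVarieties.SiegelModuli (jOfSiegel jOfSiegel_mem_C0)
open Literature.AlgebraicGeometry.Motives (SchemeOver ComplexPoints AlgPoints specOver AbelianVariety CMType)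
open Literature.AlgebraicGeometry.AbelianSchemes (PolarizedAbelianSchemeWithLevel)
open Literature.NumberTheory.Automorphic (siegelUpperHalfSpace)
open Literature.NumberTheory.ComplexMultiplication (traceField)
open Literature.AlgebraicGeometry.ShimuraVarieties (UnitaryCanonicalModel.IsArtinCorrespondent)
open Summit.HodgeConjecture.CorCM.HypDel.M1primeOfFU (MarkedBy stubW3 translateRightT isAdmissibleAt_of_markedBy)
open Summit.HodgeConjecture.HodgeConjecture.Theorems.HCCMUnconditionalSiegelDebtClosers (stubW0_holds)
open Summit.HodgeConjecture.HodgeConjecture.Theorems.MumfordRouteXi (cmConjugationIsogenyAll_holds)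

namespace Summit.HodgeConjecture.HodgeConjecture.Theorems.F0P6aSiegelCarrierReciprocity

variable {g N : ℕ} {δ : Fin g → ℕ}

/-! ### §1 The dictionary at the carrier for a given point bijection `pts` -/

/-- **THE DICTIONARY AT THE CARRIER**: for ONE fine moduli scheme `𝓜` with uniformised pieces `(Sc, ιc, unif)`, integral diagonal
representatives `rep c` (unit idèles `u c` of residue `c`, multiplier `u c`), the (U3-D3) uniqueness clause of ★ (U) at the `rep c`, and a
point bijection `pts : (𝓜.M ⊗ ℂ)(ℂ) ≃ Sh_{K_δ(N)}(ℂ)` with `pts ((ιc c)(ℂ)(unif c W)) = [J(W), rep c]`, the `ℚ`-structure point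
`(baseChangeEquiv)⁻¹ (pts⁻¹ [J, aK_δ(N)])` IS the classifying map of EVERY `(J, a)`-marked triple over `Spec ℂ` — the J1 dictionary of ★
`M1primeOfFU.StubW1a`, for an abstract `pts` (proof: ★ `SiegelShimuraSet.exists_eq_mk_jOfSiegel` + ★ `MarkedBy.transport` + (U3-D3) +
the value clause).
[cite: Milne2005ShimuraVarieties, §6 Thm. 6.11 p. 74, §5 Lemma 5.13 p. 57] [cite: MumfordFogartyKirwan1994, Ch. 7 Thm. 7.9 and App. 7A (pp. 139, 234–236)] -/
theorem classifyingMap_eq_of_markedBy (hδ : IsPolarizationType δ) (hN : 3 ≤ N) (𝓜 : SiegelFineModuliScheme g N δ)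
    {Sc : (ZMod N)ˣ → SchemeOver ℂ} (ιc : ∀ c, Sc c ⟶ (Literature.AlgebraicGeometry.Motives.baseChange ℚ ℂ).obj 𝓜.M)
    (unif : ∀ _c : (ZMod N)ˣ, Matrix (Fin g) (Fin g) ℂ → ComplexPoints (Sc _c))
    {u : (ZMod N)ˣ → finAdeleQˣ} {rep : (ZMod N)ˣ → ↥(gspFinAdelic δ)}
    (hu : ∀ c w, Valued.v ((u c : finAdeleQ) w) = 1)
    (huc : ∀ c, (u c : finAdeleQ) - ((c : ZMod N).val : ℕ) ∈ levelIdeal N)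
    (hmult : ∀ c, IsMultiplier (typeFormOver δ finAdeleQ) (rep c : GL (Fin g ⊕ Fin g) finAdeleQ) (u c))
    (hD3 : haveI : IsLocallyNoetherian (specOver ℚ ℂ).left := inferInstanceAs (IsLocallyNoetherian (Spec (CommRingCat.of ℂ)))
      ∀ (c : (ZMod N)ˣ) (Z : Matrix (Fin g) (Fin g) ℂ) (hZ : Z ∈ siegelUpperHalfSpace g)
        (P' : PolarizedAbelianSchemeWithLevel g N δ (specOver ℚ ℂ).left), IsAdmissibleAt hδ (rep c) Z hZ P' →
          AlgPoints.map (ιc c) (unif c Z) =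
            AlgPoints.baseChangeEquiv (algebraMap ℚ ℂ) 𝓜.M (𝓜.classifyingMap (specOver ℚ ℂ) P'))
    (pts : ComplexPoints ((Literature.AlgebraicGeometry.Motives.baseChange ℚ ℂ).obj 𝓜.M) ≃
      SiegelShimuraSet δ (principalLevelSubgroup δ N))
    (hval : ∀ (c : (ZMod N)ˣ) (W : Matrix (Fin g) (Fin g) ℂ) (hW : W ∈ siegelUpperHalfSpace g),
      pts (AlgPoints.map (ιc c) (unif c W)) =
        SiegelShimuraSet.mk δ (principalLevelSubgroup δ N)
          ⟨jOfSiegel δ W, C0_subset_C0pm δ (jOfSiegel_mem_C0 hδ.1 hW)⟩ (rep c))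
    (J : C0pm δ) (a : ↥(gspFinAdelic δ)) (P' : PolarizedAbelianSchemeWithLevel g N δ (specOver ℚ ℂ).left)
    (hP' : MarkedBy J a P') :
    haveI : IsLocallyNoetherian (specOver ℚ ℂ).left := inferInstanceAs (IsLocallyNoetherian (Spec (CommRingCat.of ℂ)))
    (AlgPoints.baseChangeEquiv (algebraMap ℚ ℂ) 𝓜.M).symm
        (pts.symm (SiegelShimuraSet.mk δ (principalLevelSubgroup δ N) J a)) =
      𝓜.classifyingMap (specOver ℚ ℂ) P' := by
  haveI : IsLocallyNoetherian (specOver ℚ ℂ).left := inferInstanceAs (IsLocallyNoetherian (Spec (CommRingCat.of ℂ)))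
  have hN0 : N ≠ 0 := by omega
  -- move `[J, a]` to a principal representative `[J(Z), rep c]`
  obtain ⟨c, Z, hcZ⟩ := SiegelShimuraSet.exists_eq_mk_jOfSiegel hδ hN0 hu huc hmult
    (SiegelShimuraSet.mk δ (principalLevelSubgroup δ N) J a)
  -- transport the marking along the equality of classes ((T1) rational move + (T2) integral move)
  have hmk : MarkedBy ⟨jOfSiegel δ Z, jOfSiegel_coe_mem_C0pm hδ.1 Z⟩ (rep c) P' := MarkedBy.transport translateRightT hP' hcZ
  have hadm : IsAdmissibleAt hδ (rep c) Z Z.2 P' := isAdmissibleAt_of_markedBy hδ (rep c) Z Z.2 P' hmk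
  -- (U3-D3): `unif_c Z` classifies `P′`; the value clause: `pts (unif_c Z) = [J(Z), rep c]`
  have h3 := hD3 c Z Z.2 P' hadm
  have hinc : pts.symm (SiegelShimuraSet.mk δ (principalLevelSubgroup δ N)
      ⟨jOfSiegel δ Z, jOfSiegel_coe_mem_C0pm hδ.1 Z⟩ (rep c)) = AlgPoints.map (ιc c) (unif c Z) := by
    rw [Equiv.symm_apply_eq]
    exact (hval c Z Z.2).symm
  rw [hcZ, hinc, h3, Equiv.symm_apply_apply]

/-! ### §2 `IsModuli` at the carrier, in `q`-currency -/

/-- **`IsModuli` AT THE CARRIER IN `q`-CURRENCY** (★ `SiegelRationalModel.IsModuli` :305 with the tower deleted; [Milne2005ShimuraVarieties]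
§14 p. 125 «the map `M_K → M_K(ℂ)` commutes with the actions of `Aut(ℂ)`»): under the data of §1, for `σ ∈ Aut(ℂ/ℚ)`, complex abelian
varieties `A`, `A′` marked by `[J, a]`, `[J′, a′]` and a homomorphism `f : σA → A′` carrying `σ ∘ η_a` to `η_{a′} ∘ k` for some `k ∈ K_δ(N)`
(the ★ `IsModuli` antecedent verbatim), `σ • q[J, aK_δ(N)] = q[J′, a′K_δ(N)]` on the `ℚ`-structure points of `𝓜.M`.  Proof: marked triples
`P′`, `P″` at the two classes (★ W0 `stubW0_holds`), the dictionary §1 at both, ★ W3 `M1primeOfFU.stubW3`.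
[cite: Milne2005ShimuraVarieties, §14 Prop. 14.12 p. 125 (hypothesis), §6 Thm. 6.11 p. 74] [cite: Deligne1971TravauxShimura, 4.16–4.17 p. 150] -/
theorem smul_q_mk_eq_of_conjHom (hg : 0 < g) (hδ : IsPolarizationType δ) (hN : 3 ≤ N) (𝓜 : SiegelFineModuliScheme g N δ)
    {Sc : (ZMod N)ˣ → SchemeOver ℂ} (ιc : ∀ c, Sc c ⟶ (Literature.AlgebraicGeometry.Motives.baseChange ℚ ℂ).obj 𝓜.M)
    (unif : ∀ _c : (ZMod N)ˣ, Matrix (Fin g) (Fin g) ℂ → ComplexPoints (Sc _c))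
    {u : (ZMod N)ˣ → finAdeleQˣ} {rep : (ZMod N)ˣ → ↥(gspFinAdelic δ)}
    (hu : ∀ c w, Valued.v ((u c : finAdeleQ) w) = 1)
    (huc : ∀ c, (u c : finAdeleQ) - ((c : ZMod N).val : ℕ) ∈ levelIdeal N)
    (hmult : ∀ c, IsMultiplier (typeFormOver δ finAdeleQ) (rep c : GL (Fin g ⊕ Fin g) finAdeleQ) (u c))
    (hD3 : haveI : IsLocallyNoetherian (specOver ℚ ℂ).left := inferInstanceAs (IsLocallyNoetherian (Spec (CommRingCat.of ℂ)))
      ∀ (c : (ZMod N)ˣ) (Z : Matrix (Fin g) (Fin g) ℂ) (hZ : Z ∈ siegelUpperHalfSpace g)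
        (P' : PolarizedAbelianSchemeWithLevel g N δ (specOver ℚ ℂ).left), IsAdmissibleAt hδ (rep c) Z hZ P' →
          AlgPoints.map (ιc c) (unif c Z) =
            AlgPoints.baseChangeEquiv (algebraMap ℚ ℂ) 𝓜.M (𝓜.classifyingMap (specOver ℚ ℂ) P'))
    (pts : ComplexPoints ((Literature.AlgebraicGeometry.Motives.baseChange ℚ ℂ).obj 𝓜.M) ≃
      SiegelShimuraSet δ (principalLevelSubgroup δ N))
    (hval : ∀ (c : (ZMod N)ˣ) (W : Matrix (Fin g) (Fin g) ℂ) (hW : W ∈ siegelUpperHalfSpace g),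
      pts (AlgPoints.map (ιc c) (unif c W)) =
        SiegelShimuraSet.mk δ (principalLevelSubgroup δ N)
          ⟨jOfSiegel δ W, C0_subset_C0pm δ (jOfSiegel_mem_C0 hδ.1 hW)⟩ (rep c))
    (σ : ℂ ≃ₐ[ℚ] ℂ) (J J' : C0pm δ) (a a' : ↥(gspFinAdelic δ)) (A A' : AbelianVariety ℂ)
    (m : SiegelAdelicMarking J a A) (m' : SiegelAdelicMarking J' a' A') (f : A.conjugate σ.toRingEquiv ⟶ A')
    (hf : ∃ k ∈ principalLevelSubgroup δ N, ∀ v w : Fin g ⊕ Fin g → ℚ,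
        AdelicCongr ((k * a⁻¹ : ↥(gspFinAdelic δ)) : GL (Fin g ⊕ Fin g) finAdeleQ)
            ((a'⁻¹ : ↥(gspFinAdelic δ)) : GL (Fin g ⊕ Fin g) finAdeleQ) v w →
          AlgPoints.map f.hom.hom.hom (A.conjPoints σ.toRingEquiv (m.r v)) = m'.r w) :
    σ • ((AlgPoints.baseChangeEquiv (algebraMap ℚ ℂ) 𝓜.M).symm
          (pts.symm (SiegelShimuraSet.mk δ (principalLevelSubgroup δ N) J a)) : ComplexPoints 𝓜.M) =
      (AlgPoints.baseChangeEquiv (algebraMap ℚ ℂ) 𝓜.M).symm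
        (pts.symm (SiegelShimuraSet.mk δ (principalLevelSubgroup δ N) J' a')) := by
  haveI : IsLocallyNoetherian (specOver ℚ ℂ).left := inferInstanceAs (IsLocallyNoetherian (Spec (CommRingCat.of ℂ)))
  -- marked triples over `Spec ℂ` at both classes (W0)
  obtain ⟨P', hP'⟩ := stubW0_holds g N δ hg hδ hN 𝓜 J a
  obtain ⟨P'', hP''⟩ := stubW0_holds g N δ hg hδ hN 𝓜 J' a'
  -- the dictionary at both classes, then W3 at the carrier
  rw [classifyingMap_eq_of_markedBy hδ hN 𝓜 ιc unif hu huc hmult hD3 pts hval J a P' hP',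
    classifyingMap_eq_of_markedBy hδ hN 𝓜 ιc unif hu huc hmult hD3 pts hval J' a' P'' hP'']
  exact stubW3 g N δ hg hδ hN 𝓜 σ J J' a a' A A' m m' f hf P' P'' hP' hP''

/-! ### §3 THE HEAD (E3R-S): reciprocity (62) at all CM special pairs at the carrier -/

/-- **E3R-S — SHIMURA RECIPROCITY (62) AT ALL CM SPECIAL PAIRS ON THE `ℚ`-STRUCTURE POINTS OF ONE SIEGEL FINE MODULI SCHEME**
([Milne2005ShimuraVarieties] Def. 12.8 (62) p. 114 «`σ[x, a] = [x, r_x(s)·a]`», Prop. 14.12 p. 125; [Deligne1971TravauxShimura] Déf. 3.13,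
4.18, Thm. 4.21): ★ `SiegelRationalModel.IsCanonical` :250–:262 with the tower deleted.  Under the data of §1 (ONE `𝓜`, pieces
`(Sc, ιc, unif)`, representatives `(u, rep)`, the (U3-D3) clause, the point bijection `pts` with its value clause), for every CM structure
`c` of type `δ`, complex structure `J ∈ S^±` and CM types `Φ` with `c.IsSpecial J Φ`, every number field `E ⊆ ℂ` containing all
`E*(Φᵢ)`, every `σ ∈ Aut(ℂ/E)` and finite idèle `s` of `E` with `art_E(s) = σ|_{E^{ab}}` (★ `IsArtinCorrespondent`), every `r ∈ GSp_δ(𝔸_f)`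
with matrix `c.cmRecipMatrix Φ E s`, and every `a ∈ GSp_δ(𝔸_f)`:
`(σ|_ℚ) • (baseChangeEquiv)⁻¹ (pts⁻¹ [J, aK_δ(N)]) = (baseChangeEquiv)⁻¹ (pts⁻¹ [J, r·aK_δ(N)])`.
Proof (★ `MumfordModuli.isCanonical_of_isModuli` with the tower deleted): markings of some `A`, `A′` by `[J, a]`, `[J, r·a]` exist
(★ `exists_isLatticeBasis`, ★ `SiegelAdelicMarking.exists`); the CM conjugation isogeny `f : σA → A′` matching the torsion
parametrisations is ★ `MumfordRouteXi.cmConjugationIsogenyAll_holds` (the main theorem of complex multiplication, PROVED in the tree);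
§2 `smul_q_mk_eq_of_conjHom` at `k = 1`.
[cite: Milne2005ShimuraVarieties, Def. 12.8 (62) p. 114, §14 Prop. 14.12 p. 125, §11 Thm. 11.2 p. 108]
[cite: Deligne1971TravauxShimura, Déf. 3.13 p. 141, 4.18 p. 150, Thm. 4.21 p. 152] [cite: Shimura1998, §18.6 Thm. 18.6 pp. 124–125] -/
theorem smul_q_mk_eq_q_mk_cmRecip (hg : 0 < g) (hδ : IsPolarizationType δ) (hN : 3 ≤ N) (𝓜 : SiegelFineModuliScheme g N δ)
    {Sc : (ZMod N)ˣ → SchemeOver ℂ} (ιc : ∀ c, Sc c ⟶ (Literature.AlgebraicGeometry.Motives.baseChange ℚ ℂ).obj 𝓜.M)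
    (unif : ∀ _c : (ZMod N)ˣ, Matrix (Fin g) (Fin g) ℂ → ComplexPoints (Sc _c))
    {u : (ZMod N)ˣ → finAdeleQˣ} {rep : (ZMod N)ˣ → ↥(gspFinAdelic δ)}
    (hu : ∀ c w, Valued.v ((u c : finAdeleQ) w) = 1)
    (huc : ∀ c, (u c : finAdeleQ) - ((c : ZMod N).val : ℕ) ∈ levelIdeal N)
    (hmult : ∀ c, IsMultiplier (typeFormOver δ finAdeleQ) (rep c : GL (Fin g ⊕ Fin g) finAdeleQ) (u c))
    (hD3 : haveI : IsLocallyNoetherian (specOver ℚ ℂ).left := inferInstanceAs (IsLocallyNoetherian (Spec (CommRingCat.of ℂ)))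
      ∀ (c : (ZMod N)ˣ) (Z : Matrix (Fin g) (Fin g) ℂ) (hZ : Z ∈ siegelUpperHalfSpace g)
        (P' : PolarizedAbelianSchemeWithLevel g N δ (specOver ℚ ℂ).left), IsAdmissibleAt hδ (rep c) Z hZ P' →
          AlgPoints.map (ιc c) (unif c Z) =
            AlgPoints.baseChangeEquiv (algebraMap ℚ ℂ) 𝓜.M (𝓜.classifyingMap (specOver ℚ ℂ) P'))
    (pts : ComplexPoints ((Literature.AlgebraicGeometry.Motives.baseChange ℚ ℂ).obj 𝓜.M) ≃
      SiegelShimuraSet δ (principalLevelSubgroup δ N))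
    (hval : ∀ (c : (ZMod N)ˣ) (W : Matrix (Fin g) (Fin g) ℂ) (hW : W ∈ siegelUpperHalfSpace g),
      pts (AlgPoints.map (ιc c) (unif c W)) =
        SiegelShimuraSet.mk δ (principalLevelSubgroup δ N)
          ⟨jOfSiegel δ W, C0_subset_C0pm δ (jOfSiegel_mem_C0 hδ.1 hW)⟩ (rep c))
    (ι : Type) [Fintype ι] [DecidableEq ι] (K : ι → Type) [∀ i, Field (K i)] [∀ i, NumberField (K i)]
    [∀ i, IsCMField (K i)] (c : CMStructure g δ ι K) (J : C0pm δ) (Φ : ∀ i, CMType (K i)) (hsp : c.IsSpecial J Φ)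
    (E : IntermediateField ℚ ℂ) [FiniteDimensional ℚ ↥E] (hE : ∀ i, traceField (Φ i) ≤ E) :
    haveI : NumberField ↥E := NumberField.mk
    ∀ (σ : ℂ ≃ₐ[↥E] ℂ) (s : (FiniteAdeleRing (𝓞 ↥E) ↥E)ˣ),
      UnitaryCanonicalModel.IsArtinCorrespondent ↥E (algebraMap ↥E ℂ) s σ.toRingEquiv →
      ∀ r : ↥(gspFinAdelic δ),
        ((r : GL (Fin g ⊕ Fin g) (FiniteAdeleRing (𝓞 ℚ) ℚ)) :
            Matrix (Fin g ⊕ Fin g) (Fin g ⊕ Fin g) (FiniteAdeleRing (𝓞 ℚ) ℚ)) = c.cmRecipMatrix Φ E s →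
        ∀ a : ↥(gspFinAdelic δ),
          (σ.restrictScalars ℚ) • ((AlgPoints.baseChangeEquiv (algebraMap ℚ ℂ) 𝓜.M).symm
                (pts.symm (SiegelShimuraSet.mk δ (principalLevelSubgroup δ N) J a)) : ComplexPoints 𝓜.M) =
            (AlgPoints.baseChangeEquiv (algebraMap ℚ ℂ) 𝓜.M).symm
              (pts.symm (SiegelShimuraSet.mk δ (principalLevelSubgroup δ N) J (r * a))) := by
  intro σ s hs r hr a
  -- markings of some complex abelian varieties by `[J, a]` and `[J, r·a]`
  obtain ⟨γ, hγ⟩ := exists_isLatticeBasis a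
  obtain ⟨A, ⟨m⟩⟩ := SiegelAdelicMarking.exists J a γ hγ
  obtain ⟨γ', hγ'⟩ := exists_isLatticeBasis (r * a)
  obtain ⟨A', ⟨m'⟩⟩ := SiegelAdelicMarking.exists J (r * a) γ' hγ'
  -- the CM conjugation isogeny `σA → A′` (main theorem of complex multiplication, ∀-markings form)
  obtain ⟨f, hf⟩ := cmConjugationIsogenyAll_holds g δ hg hδ ι K c J Φ hsp E hE σ s hs r hr a A A' m m'
  exact smul_q_mk_eq_of_conjHom hg hδ hN 𝓜 ιc unif hu huc hmult hD3 pts hval (σ.restrictScalars ℚ) J J a (r * a)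
    A A' m m' f ⟨1, (principalLevelSubgroup δ N).one_mem, hf⟩

/-- **E3R-S FOR A `ℚ`-AUTOMORPHISM FIXING `E` POINTWISE** (the shape of A-p09's E3R-U head `exists_sliceField_siegelRecipDatum` and of
`AuxChartGS.f_recip`, which act by `σ.restrictScalars ℚ`): same data as `smul_q_mk_eq_q_mk_cmRecip`, with `σ : ℂ ≃ₐ[ℚ] ℂ` and
`σ x = x` for `x ∈ E` in place of `σ : ℂ ≃ₐ[E] ℂ`; the Artin-correspondent clause and the conclusion are read on `σ` itself.  Proof: promote
`σ` to an `E`-algebra automorphism (Mathlib `AlgEquiv.ofRingEquiv`) and apply the head.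
[cite: Milne2005ShimuraVarieties, Def. 12.8 (62) p. 114, §14 Prop. 14.12 p. 125] [cite: Deligne1971TravauxShimura, Thm. 4.21 p. 152] -/
theorem smul_q_mk_eq_q_mk_cmRecip_of_forall_mem_apply_eq (hg : 0 < g) (hδ : IsPolarizationType δ) (hN : 3 ≤ N)
    (𝓜 : SiegelFineModuliScheme g N δ)
    {Sc : (ZMod N)ˣ → SchemeOver ℂ} (ιc : ∀ c, Sc c ⟶ (Literature.AlgebraicGeometry.Motives.baseChange ℚ ℂ).obj 𝓜.M)
    (unif : ∀ _c : (ZMod N)ˣ, Matrix (Fin g) (Fin g) ℂ → ComplexPoints (Sc _c))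
    {u : (ZMod N)ˣ → finAdeleQˣ} {rep : (ZMod N)ˣ → ↥(gspFinAdelic δ)}
    (hu : ∀ c w, Valued.v ((u c : finAdeleQ) w) = 1)
    (huc : ∀ c, (u c : finAdeleQ) - ((c : ZMod N).val : ℕ) ∈ levelIdeal N)
    (hmult : ∀ c, IsMultiplier (typeFormOver δ finAdeleQ) (rep c : GL (Fin g ⊕ Fin g) finAdeleQ) (u c))
    (hD3 : haveI : IsLocallyNoetherian (specOver ℚ ℂ).left := inferInstanceAs (IsLocallyNoetherian (Spec (CommRingCat.of ℂ)))
      ∀ (c : (ZMod N)ˣ) (Z : Matrix (Fin g) (Fin g) ℂ) (hZ : Z ∈ siegelUpperHalfSpace g)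
        (P' : PolarizedAbelianSchemeWithLevel g N δ (specOver ℚ ℂ).left), IsAdmissibleAt hδ (rep c) Z hZ P' →
          AlgPoints.map (ιc c) (unif c Z) =
            AlgPoints.baseChangeEquiv (algebraMap ℚ ℂ) 𝓜.M (𝓜.classifyingMap (specOver ℚ ℂ) P'))
    (pts : ComplexPoints ((Literature.AlgebraicGeometry.Motives.baseChange ℚ ℂ).obj 𝓜.M) ≃
      SiegelShimuraSet δ (principalLevelSubgroup δ N))
    (hval : ∀ (c : (ZMod N)ˣ) (W : Matrix (Fin g) (Fin g) ℂ) (hW : W ∈ siegelUpperHalfSpace g),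
      pts (AlgPoints.map (ιc c) (unif c W)) =
        SiegelShimuraSet.mk δ (principalLevelSubgroup δ N)
          ⟨jOfSiegel δ W, C0_subset_C0pm δ (jOfSiegel_mem_C0 hδ.1 hW)⟩ (rep c))
    (ι : Type) [Fintype ι] [DecidableEq ι] (K : ι → Type) [∀ i, Field (K i)] [∀ i, NumberField (K i)]
    [∀ i, IsCMField (K i)] (c : CMStructure g δ ι K) (J : C0pm δ) (Φ : ∀ i, CMType (K i)) (hsp : c.IsSpecial J Φ)
    (E : IntermediateField ℚ ℂ) [FiniteDimensional ℚ ↥E] (hE : ∀ i, traceField (Φ i) ≤ E) :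
    haveI : NumberField ↥E := NumberField.mk
    ∀ (σ : ℂ ≃ₐ[ℚ] ℂ), (∀ x ∈ E, σ x = x) → ∀ (s : (FiniteAdeleRing (𝓞 ↥E) ↥E)ˣ),
      UnitaryCanonicalModel.IsArtinCorrespondent ↥E (algebraMap ↥E ℂ) s σ.toRingEquiv →
      ∀ r : ↥(gspFinAdelic δ),
        ((r : GL (Fin g ⊕ Fin g) (FiniteAdeleRing (𝓞 ℚ) ℚ)) :
            Matrix (Fin g ⊕ Fin g) (Fin g ⊕ Fin g) (FiniteAdeleRing (𝓞 ℚ) ℚ)) = c.cmRecipMatrix Φ E s →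
        ∀ a : ↥(gspFinAdelic δ),
          σ • ((AlgPoints.baseChangeEquiv (algebraMap ℚ ℂ) 𝓜.M).symm
                (pts.symm (SiegelShimuraSet.mk δ (principalLevelSubgroup δ N) J a)) : ComplexPoints 𝓜.M) =
            (AlgPoints.baseChangeEquiv (algebraMap ℚ ℂ) 𝓜.M).symm
              (pts.symm (SiegelShimuraSet.mk δ (principalLevelSubgroup δ N) J (r * a))) := by
  intro σ hσE s hs r hr a
  haveI : NumberField ↥E := NumberField.mk
  -- promote `σ` to an `E`-algebra automorphism of `ℂ`
  let σE : ℂ ≃ₐ[↥E] ℂ := AlgEquiv.ofRingEquiv (f := σ.toRingEquiv) fun x => hσE x x.2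
  have h1 : σE.restrictScalars ℚ = σ := AlgEquiv.ext fun _ => rfl
  have h2 : σE.toRingEquiv = σ.toRingEquiv := RingEquiv.ext fun _ => rfl
  have hsE : UnitaryCanonicalModel.IsArtinCorrespondent ↥E (algebraMap ↥E ℂ) s σE.toRingEquiv := by rw [h2]; exact hs
  have h := smul_q_mk_eq_q_mk_cmRecip hg hδ hN 𝓜 ιc unif hu huc hmult hD3 pts hval ι K c J Φ hsp E hE σE s hsE r hr a
  rwa [h1] at h

/-- **E3R-S WITH THE (U3) CLAUSE OF ★ (U) AND A4's `(u, rep)` CLAUSE TAKEN VERBATIM** (zero adapters for the `stub_E123` closure: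
`hU3` = the last conjunct of ★ `siegelModuli_complexUniformisation_holds g N δ hg hδ hN 𝓜` destructured at the chosen `(Sc, ιc, unif)`,
`hrep` ∕ `hval` = the first and last output clauses of A4 ★ `UnitaryCurve.exists_moduliPointMapGS`).  Same statement and proof as
`smul_q_mk_eq_q_mk_cmRecip`; only (U3-D3) of `hU3` is used.
[cite: Milne2005ShimuraVarieties, Def. 12.8 (62) p. 114, §14 Prop. 14.12 p. 125] [cite: Deligne1971TravauxShimura, Thm. 4.21 p. 152]
[cite: MumfordFogartyKirwan1994, Appendix to Ch. 7 §A (pp. 234–235)] -/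
theorem smul_q_mk_eq_q_mk_cmRecip' (hg : 0 < g) (hδ : IsPolarizationType δ) (hN : 3 ≤ N)
    (𝓜 : SiegelFineModuliScheme g N δ)
    {Sc : (ZMod N)ˣ → SchemeOver ℂ} (ιc : ∀ c, Sc c ⟶ (Literature.AlgebraicGeometry.Motives.baseChange ℚ ℂ).obj 𝓜.M)
    (unif : ∀ _c : (ZMod N)ˣ, Matrix (Fin g) (Fin g) ℂ → ComplexPoints (Sc _c))
    (hU3 : haveI : IsLocallyNoetherian (specOver ℚ ℂ).left := inferInstanceAs (IsLocallyNoetherian (Spec (CommRingCat.of ℂ)))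
      ∀ (c : (ZMod N)ˣ) (u : finAdeleQˣ) (r : ↥(gspFinAdelic δ)),
        (∀ v, Valued.v ((u : finAdeleQ) v) = 1) →
        (u : finAdeleQ) - ((c : ZMod N).val : ℕ) ∈ levelIdeal N →
        r ∈ principalLevelSubgroup δ 1 →
        IsMultiplier (typeFormOver δ finAdeleQ) (r : GL (Fin g ⊕ Fin g) finAdeleQ) u →
        ((r : GL (Fin g ⊕ Fin g) finAdeleQ) : Matrix (Fin g ⊕ Fin g) (Fin g ⊕ Fin g) finAdeleQ) =
          Matrix.fromBlocks 1 0 0 ((u : finAdeleQ) • (1 : Matrix (Fin g) (Fin g) finAdeleQ)) →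
        ∀ (Z : Matrix (Fin g) (Fin g) ℂ) (hZ : Z ∈ siegelUpperHalfSpace g),
          (∃ (P' : PolarizedAbelianSchemeWithLevel g N δ (specOver ℚ ℂ).left)
              (G : P'.A.X.left ⟶ 𝓜.univ.A.X.left) (Ĝ : P'.D.hat.X.left ⟶ 𝓜.univ.D.hat.X.left),
              P'.IsBaseChangeVia 𝓜.univ
                  ((AlgPoints.baseChangeEquiv (algebraMap ℚ ℂ) 𝓜.M).symm (AlgPoints.map (ιc c) (unif c Z))).left G Ĝ ∧
              IsAdmissibleAt hδ r Z hZ P') ∧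
          (∀ (P' : PolarizedAbelianSchemeWithLevel g N δ (specOver ℚ ℂ).left), IsAdmissibleAt hδ r Z hZ P' →
              AlgPoints.map (ιc c) (unif c Z)
                = AlgPoints.baseChangeEquiv (algebraMap ℚ ℂ) 𝓜.M (𝓜.classifyingMap (specOver ℚ ℂ) P')))
    {u : (ZMod N)ˣ → finAdeleQˣ} {rep : (ZMod N)ˣ → ↥(gspFinAdelic δ)}
    (hrep : ∀ c, (∀ w, Valued.v ((u c : finAdeleQ) w) = 1) ∧ (u c : finAdeleQ) - ((c : ZMod N).val : ℕ) ∈ levelIdeal N ∧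
        rep c ∈ principalLevelSubgroup δ 1 ∧
          IsMultiplier (typeFormOver δ finAdeleQ) (rep c : GL (Fin g ⊕ Fin g) finAdeleQ) (u c) ∧
            ((rep c : GL (Fin g ⊕ Fin g) finAdeleQ) : Matrix (Fin g ⊕ Fin g) (Fin g ⊕ Fin g) finAdeleQ) =
              Matrix.fromBlocks 1 0 0 ((u c : finAdeleQ) • (1 : Matrix (Fin g) (Fin g) finAdeleQ)))
    (pts : ComplexPoints ((Literature.AlgebraicGeometry.Motives.baseChange ℚ ℂ).obj 𝓜.M) ≃
      SiegelShimuraSet δ (principalLevelSubgroup δ N))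
    (hval : ∀ (c : (ZMod N)ˣ) (W : Matrix (Fin g) (Fin g) ℂ) (hW : W ∈ siegelUpperHalfSpace g),
      pts (AlgPoints.map (ιc c) (unif c W)) =
        SiegelShimuraSet.mk δ (principalLevelSubgroup δ N)
          ⟨jOfSiegel δ W, C0_subset_C0pm δ (jOfSiegel_mem_C0 hδ.1 hW)⟩ (rep c))
    (ι : Type) [Fintype ι] [DecidableEq ι] (K : ι → Type) [∀ i, Field (K i)] [∀ i, NumberField (K i)]
    [∀ i, IsCMField (K i)] (c : CMStructure g δ ι K) (J : C0pm δ) (Φ : ∀ i, CMType (K i)) (hsp : c.IsSpecial J Φ)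
    (E : IntermediateField ℚ ℂ) [FiniteDimensional ℚ ↥E] (hE : ∀ i, traceField (Φ i) ≤ E) :
    haveI : NumberField ↥E := NumberField.mk
    ∀ (σ : ℂ ≃ₐ[↥E] ℂ) (s : (FiniteAdeleRing (𝓞 ↥E) ↥E)ˣ),
      UnitaryCanonicalModel.IsArtinCorrespondent ↥E (algebraMap ↥E ℂ) s σ.toRingEquiv →
      ∀ r : ↥(gspFinAdelic δ),
        ((r : GL (Fin g ⊕ Fin g) (FiniteAdeleRing (𝓞 ℚ) ℚ)) :
            Matrix (Fin g ⊕ Fin g) (Fin g ⊕ Fin g) (FiniteAdeleRing (𝓞 ℚ) ℚ)) = c.cmRecipMatrix Φ E s →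
        ∀ a : ↥(gspFinAdelic δ),
          (σ.restrictScalars ℚ) • ((AlgPoints.baseChangeEquiv (algebraMap ℚ ℂ) 𝓜.M).symm
                (pts.symm (SiegelShimuraSet.mk δ (principalLevelSubgroup δ N) J a)) : ComplexPoints 𝓜.M) =
            (AlgPoints.baseChangeEquiv (algebraMap ℚ ℂ) 𝓜.M).symm
              (pts.symm (SiegelShimuraSet.mk δ (principalLevelSubgroup δ N) J (r * a))) :=
  smul_q_mk_eq_q_mk_cmRecip hg hδ hN 𝓜 ιc unif (fun c => (hrep c).1) (fun c => (hrep c).2.1)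
    (fun c => (hrep c).2.2.2.1)
    (fun c Z hZ P' h => (hU3 c (u c) (rep c) (hrep c).1 (hrep c).2.1 (hrep c).2.2.1 (hrep c).2.2.2.1
      (hrep c).2.2.2.2 Z hZ).2 P' h)
    pts hval ι K c J Φ hsp E hE

end Summit.HodgeConjecture.HodgeConjecture.Theorems.F0P6aSiegelCarrierReciprocity

end
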